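import Summits.QuantumFields.YangMills.Theorems.UnitScaleTiltProp7TrueLinSourcedSparseL1
import Summits.QuantumFields.YangMills.Theorems.UnitScaleTiltProp7CurvedLandauRowA
import HarnessLib

/-!
# Route `UnitScaleTilt`, crux K1 «MinimiserStabilityRegPr» (stmt-QuantumFields-19200), route-R (β) R0 REM2ˢ, row «(n3)₂-sym» = H2-1ˢ, file N6a —
# THE SECOND-ORDER REMAINDER OF THE LEVEL RATIOS IN `ℓ¹` FROM THE SPARSE ENGINE: `Σ_c‖Y_k(c) − Q^{(k)}X(c)‖` is bounded by the DAMPED level masses of the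
# first-order ratio field (mass channel) plus, per level `j < k` and per centre `z`, the LOCALISED masses `Σ_{b∈C^{z}_i}‖Y_i(b)‖²` on ANY nested support family around
# the block `B(z)` (coarse-gauge channel) — the localisation inequality itself stays the consumer's (N4), as do the centre chains and support families (N2′)

Cell `ym3-torus` (HUMAN RULING D-0037: YM₃ on the three-torus is ladder rung R3 — not d = 4, not infinite volume, not a mass gap, not Clay), width seat `ym3-torus-px21` (gen 7),
pen of the «(n3)₂-sym» supplier (px13 g6 «GO» 2026-08-29 07:50Z), LOCATE «H2-1ˢ» (19200 evidence #52).  THEOREMS ONLY (0 `def`, 0 `sorry`); `--supports stmt-QuantumFields-19200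
--as helper`, count-neutral.  Nothing here claims the «(n3)₂-sym» row, `hMcomb₂`, (β), the stub, the crux, d = 4 or the mass gap.

THE POINT.  With `Y_j := pertVar Ū₀^{(j)} W̄^{(j)}` the family `D′_j := Y_j − Q^{(j)}X` is driven by the true one-step linearisations with the one-step remainders
`R_j = Y_{j+1} − T_jY_j` as sources and the initial value `D′_0 = Y − X` (✓A1 `sub_sourced`; the template is ★routeR-w6 g3's ✓`Prop7FibreTrueLinDefectL1` §2, which fed 1b's
GLOBAL two-channel engine and lost the factor `ℓ` in the coarse-gauge channel).  THIS FILE feeds ✓p708624 `Prop7TrueLinSourcedSparseL1.sum_norm_sourced_le_sparse` instead: the mass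
channel is 1b's verbatim, with the sources priced by px7 g4's E10-loc ✓`PoincareLipschitzTrueLinBoxLocalRows.sum_norm_ratio_sub_trueLin_le_mass_local` at `C = S = univ`
(`Σ_c‖R_j(c)‖ ≤ 260((d+2)L)²(2dL^d)(2d)·Σ_b‖Y_j(b)‖²`); the coarse-gauge channel reads the reduced family only on the blocks under the centre chains `S_{j+1}`, where
✓p708624 §2 (`sum_norm_sourcedReduced_le_local`) on a nested support family `C^{z}_i ⊇ N(C^{z}_{i+1})`, `C^{z}_j ⊇ {b : blockOf b₋ = z}`, and the same E10-loc at
`C = C^{z}_{i+1}`, `S = C^{z}_i` price it by LOCALISED first-order masses.  Every family (`S`, `C`) is DISPLAYED and arbitrary; the windows are 1b's loop sizes `a_j` and E10's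
sup sizes `s_j`.

WHAT IS PROVED (ns `…Theorems.Prop7N32SymSparseRow`; `SU(N)`, any `P`, `k ≤ m + K`).
* ★★★ `sum_norm_levelRatio_sub_trueLinIter_le_sparse` — with `ρ₁ = (L^d)⁻¹L`, `κ₁ = 159(d+2)L·2d`, `E_j = exp((κ₁∕ρ₁)Σ_{i<j}a_i)`, `c_E = 260((d+2)L)²(2dL^d)(2d)`:
  `Σ_c‖Y_k(c) − Q k X c‖ ≤ E_k·(ρ₁ᵏ·Σ_b‖Y(b) − X(b)‖ + Σ_{i<k}ρ₁^{k−1−i}·c_E·Σ_b‖Y_i(b)‖²)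
     + 2d·Σ_{j<k}(d+2)L·Σ_{z∈S_{j+1}} E_j·(ρ₁ʲ·Σ_{b∈C^{z}_0}‖Y(b) − X(b)‖ + Σ_{i<j}ρ₁^{j−1−i}·c_E·Σ_{b∈C^{z}_i}‖Y_i(b)‖²)`.
HONEST SCOPE.  Bookkeeping over landed bricks (✓p708624, ✓A1, px7 g4 E10-loc); the localised masses on the right are NOT estimated here (N3∕N4∕N4b∕N5∕N6b do that); nothing of
[Balaban1985Averaging] ∕ [Balaban1984PropagatorsI] is asserted beyond the cited tree theorems.
References: T. Bałaban, CMP 98 (1985) 17–51 [Balaban1985Averaging] (Prop. 3 (122)–(126) p.36); CMP 95 (1984) 17–40 [Balaban1984PropagatorsI] ((1.18)–(1.20) pp.19–20);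
CMP 102 (1985) 277–309 [Balaban1985Variational] ((15) p.280, Prop. 7 p.299); CMP 109 (1987) 249–301 [Balaban1987RG1] ((0.3)–(0.4) pp.252–253).
-/

set_option autoImplicit false

noncomputable section

open scoped BigOperators Matrix.Norms.L2Operator

namespace Summit.QuantumFields.YangMills.Theorems.Prop7N32SymSparseRow

open Literature.MathematicalPhysics.QuantumFieldTheory.Balaban1983to89
open Finset T4Continuum BlockAveraging AveragingRT ExpMeanLog BlockAveragingEMLLinearised BlockAveragingEMLLinearisedBackground BlockAveragingEMLProp2
open Summit.QuantumFields.YangMills.Theorems.Prop7TrueLinSourcedStructure (exists_sourced_reduced_family sub_sourced)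
open Summit.QuantumFields.YangMills.Theorems.Prop7TrueLinSourcedSparseL1 (sum_norm_sourced_le_sparse sum_norm_sourcedReduced_le_local)
open Summit.QuantumFields.YangMills.Theorems.Prop7CurvedLandauRowA (exists_coarseGauge_family)
open Summit.QuantumFields.YangMills.Theorems.PoincareLipschitzTrueLinBoxLocalRows (sum_norm_ratio_sub_trueLin_le_mass_local)

variable {P : Params} {N : ℕ} [NeZero N]

/-- ★★★ **THE SECOND-ORDER REMAINDER OF THE LEVEL RATIOS IN `ℓ¹` FROM THE SPARSE ENGINE.**  `U₀, W ∈ SU(N)` on the finest torus, `k ≤ m + K`; `Q` the true linearised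
iterate along the tower of `U₀` (`hQ0`, `hQs`); `X` any initial field; loop sizes `dist1(W^{(j)}_i(c)) ≤ a j ≤ 1/24`, `a j < δ_N`; sup sizes `‖Y_j(b)‖ ≤ s j` with E10's windows
`72·((d+2)L·(2dL^d·s_j)) ≤ 1`, `3·(…) + a_j < δ_N`; centre chains `S_i` (`emb(S_{i+1}) ⊆ S_i`, `S_k = univ`); for every `j < k` and `z ∈ S_{j+1}` a nested support family
`C^{z}_i` (`{b : blockOf b₋ = z} ⊆ C^{z}_j`, `N(c) ⊆ C^{z}_i` for `c ∈ C^{z}_{i+1}`).  Then the title inequality holds (docstring of the file).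
[cite: Balaban1985Averaging, Prop. 3 (122)-(126) p.36; Balaban1984PropagatorsI, (1.18)-(1.20) pp.19-20; Balaban1985Variational, (15) p.280, Prop. 7 p.299] -/
theorem sum_norm_levelRatio_sub_trueLinIter_le_sparse (U₀ W : GaugeField P 0 (Matrix.specialUnitaryGroup (Fin N) ℂ)) {k : ℕ} (hk : k ≤ P.m + P.K)
    (Q : (k : ℕ) → (PBond P 0 → Matrix (Fin N) (Fin N) ℂ) → PBond P k → Matrix (Fin N) (Fin N) ℂ) (hQ0 : ∀ Y, Q 0 Y = Y)
    (hQs : ∀ (k : ℕ) (Y : PBond P 0 → Matrix (Fin N) (Fin N) ℂ) (c : PBond P (k + 1)), Q (k + 1) Y c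
      = (fderiv ℂ (eml : (Idx P → Matrix (Fin N) (Fin N) ℂ) → Matrix (Fin N) (Fin N) ℂ)
            (fun i => ((loopHol (Averaging.iter (fun i => blockAvg (P := P) (j := i) (expMeanLogSU (n := Fin N))) k U₀) c i : Matrix.specialUnitaryGroup (Fin N) ℂ) : Matrix (Fin N) (Fin N) ℂ))
            (fun i => covWalkSum (Averaging.iter (fun i => blockAvg (P := P) (j := i) (expMeanLogSU (n := Fin N))) k U₀) (Q k Y) (walk (emb c.src) (loopWord P.L c.dir (off i.1) i.2.1 i.2.2))
              * ((loopHol (Averaging.iter (fun i => blockAvg (P := P) (j := i) (expMeanLogSU (n := Fin N))) k U₀) c i : Matrix.specialUnitaryGroup (Fin N) ℂ) : Matrix (Fin N) (Fin N) ℂ))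
            * star ((corr (expMeanLogSU (n := Fin N)) (Averaging.iter (fun i => blockAvg (P := P) (j := i) (expMeanLogSU (n := Fin N))) k U₀) c : Matrix.specialUnitaryGroup (Fin N) ℂ) : Matrix (Fin N) (Fin N) ℂ)
          + ((corr (expMeanLogSU (n := Fin N)) (Averaging.iter (fun i => blockAvg (P := P) (j := i) (expMeanLogSU (n := Fin N))) k U₀) c : Matrix.specialUnitaryGroup (Fin N) ℂ) : Matrix (Fin N) (Fin N) ℂ)
            * covWalkSum (Averaging.iter (fun i => blockAvg (P := P) (j := i) (expMeanLogSU (n := Fin N))) k U₀) (Q k Y) (walk (emb c.src) (List.replicate P.L (c.dir, true)))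
            * star ((corr (expMeanLogSU (n := Fin N)) (Averaging.iter (fun i => blockAvg (P := P) (j := i) (expMeanLogSU (n := Fin N))) k U₀) c : Matrix.specialUnitaryGroup (Fin N) ℂ) : Matrix (Fin N) (Fin N) ℂ)))
    (X : PBond P 0 → Matrix (Fin N) (Fin N) ℂ)
    (a : ℕ → ℝ) (ha0 : ∀ j, 0 ≤ a j)
    (hα : ∀ j < k, ∀ (c : PBond P (j + 1)) (i : Idx P), dist1 (loopHol (Averaging.iter (fun i => blockAvg (P := P) (j := i) (expMeanLogSU (n := Fin N))) j U₀) c i) ≤ a j)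
    (ha24 : ∀ j < k, a j ≤ 1 / 24) (haN : ∀ j < k, a j < deltaSU (Fin N))
    (s : ℕ → ℝ) (hs0 : ∀ j < k, 0 ≤ s j)
    (hs : ∀ j < k, ∀ b : PBond P j, ‖(pertVar (Averaging.iter (fun i => blockAvg (P := P) (j := i) (expMeanLogSU (n := Fin N))) j U₀) (Averaging.iter (fun i => blockAvg (P := P) (j := i) (expMeanLogSU (n := Fin N))) j W)) b‖ ≤ s j)
    (h72 : ∀ j < k, 72 * ((((P.d + 2) * P.L : ℕ) : ℝ) * ((2 * P.d * (P.L : ℝ) ^ P.d) * s j)) ≤ 1)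
    (hsN : ∀ j < k, 3 * ((((P.d + 2) * P.L : ℕ) : ℝ) * ((2 * P.d * (P.L : ℝ) ^ P.d) * s j)) + a j < deltaSU (Fin N))
    (S : (i : ℕ) → Finset (Site P i)) (hS : ∀ i < k, ∀ z ∈ S (i + 1), emb z ∈ S i) (hSk : S k = univ)
    (C : (j : ℕ) → Site P (j + 1) → (i : ℕ) → Finset (PBond P i))
    (hCtop : ∀ j < k, ∀ z ∈ S (j + 1), ∀ b : PBond P j, blockOf b.src = z → b ∈ C j z j)
    (hCnest : ∀ j < k, ∀ z ∈ S (j + 1), ∀ i < j, ∀ c ∈ C j z (i + 1), ∀ b : PBond P i, (blockOf b.src = c.src ∨ blockOf b.src = c.tgt) → b ∈ C j z i) :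
    ∑ c : PBond P k, ‖(pertVar (Averaging.iter (fun i => blockAvg (P := P) (j := i) (expMeanLogSU (n := Fin N))) k U₀) (Averaging.iter (fun i => blockAvg (P := P) (j := i) (expMeanLogSU (n := Fin N))) k W)) c - Q k X c‖
      ≤ Real.exp ((159 * (((P.d + 2) * P.L : ℕ) : ℝ) * (2 * P.d)) / (((P.L : ℝ) ^ P.d)⁻¹ * (P.L : ℝ)) * ∑ i ∈ Finset.range k, a i)
          * ((((P.L : ℝ) ^ P.d)⁻¹ * (P.L : ℝ)) ^ k * (∑ b : PBond P 0, ‖pertVar U₀ W b - X b‖)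
            + ∑ i ∈ Finset.range k, (((P.L : ℝ) ^ P.d)⁻¹ * (P.L : ℝ)) ^ (k - 1 - i) * ((260 * ((((P.d + 2) * P.L : ℕ) : ℝ)) ^ 2 * (2 * P.d * (P.L : ℝ) ^ P.d) * (2 * P.d)) * ∑ b : PBond P i, ‖(pertVar (Averaging.iter (fun i => blockAvg (P := P) (j := i) (expMeanLogSU (n := Fin N))) i U₀) (Averaging.iter (fun i => blockAvg (P := P) (j := i) (expMeanLogSU (n := Fin N))) i W)) b‖ ^ 2))
        + 2 * P.d * ∑ j ∈ Finset.range k, (((P.d + 2) * P.L : ℕ) : ℝ) * ∑ z ∈ S (j + 1),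
            Real.exp ((159 * (((P.d + 2) * P.L : ℕ) : ℝ) * (2 * P.d)) / (((P.L : ℝ) ^ P.d)⁻¹ * (P.L : ℝ)) * ∑ i ∈ Finset.range j, a i)
              * ((((P.L : ℝ) ^ P.d)⁻¹ * (P.L : ℝ)) ^ j * (∑ b ∈ C j z 0, ‖pertVar U₀ W b - X b‖)
                + ∑ i ∈ Finset.range j, (((P.L : ℝ) ^ P.d)⁻¹ * (P.L : ℝ)) ^ (j - 1 - i) * ((260 * ((((P.d + 2) * P.L : ℕ) : ℝ)) ^ 2 * (2 * P.d * (P.L : ℝ) ^ P.d) * (2 * P.d)) * ∑ b ∈ C j z i, ‖(pertVar (Averaging.iter (fun i => blockAvg (P := P) (j := i) (expMeanLogSU (n := Fin N))) i U₀) (Averaging.iter (fun i => blockAvg (P := P) (j := i) (expMeanLogSU (n := Fin N))) i W)) b‖ ^ 2)) := by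
  -- abbreviations (definitional): the level ratio family and the one-step remainders
  obtain ⟨Yf, hYf⟩ : ∃ Yf : (j : ℕ) → PBond P j → Matrix (Fin N) (Fin N) ℂ, Yf = (fun j => (pertVar (Averaging.iter (fun i => blockAvg (P := P) (j := i) (expMeanLogSU (n := Fin N))) j U₀) (Averaging.iter (fun i => blockAvg (P := P) (j := i) (expMeanLogSU (n := Fin N))) j W))) := ⟨_, rfl⟩
  obtain ⟨R, hRf⟩ : ∃ R : (j : ℕ) → PBond P (j + 1) → Matrix (Fin N) (Fin N) ℂ, R = (fun j c => ((pertVar (Averaging.iter (fun i => blockAvg (P := P) (j := i) (expMeanLogSU (n := Fin N))) (j + 1) U₀) (Averaging.iter (fun i => blockAvg (P := P) (j := i) (expMeanLogSU (n := Fin N))) (j + 1) W)) c - (fderiv ℂ (eml : (Idx P → Matrix (Fin N) (Fin N) ℂ) → Matrix (Fin N) (Fin N) ℂ)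
            (fun i => ((loopHol (Averaging.iter (fun i => blockAvg (P := P) (j := i) (expMeanLogSU (n := Fin N))) j U₀) c i : Matrix.specialUnitaryGroup (Fin N) ℂ) : Matrix (Fin N) (Fin N) ℂ))
            (fun i => covWalkSum (Averaging.iter (fun i => blockAvg (P := P) (j := i) (expMeanLogSU (n := Fin N))) j U₀) (pertVar (Averaging.iter (fun i => blockAvg (P := P) (j := i) (expMeanLogSU (n := Fin N))) j U₀) (Averaging.iter (fun i => blockAvg (P := P) (j := i) (expMeanLogSU (n := Fin N))) j W)) (walk (emb c.src) (loopWord P.L c.dir (off i.1) i.2.1 i.2.2))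
              * ((loopHol (Averaging.iter (fun i => blockAvg (P := P) (j := i) (expMeanLogSU (n := Fin N))) j U₀) c i : Matrix.specialUnitaryGroup (Fin N) ℂ) : Matrix (Fin N) (Fin N) ℂ))
            * star ((corr (expMeanLogSU (n := Fin N)) (Averaging.iter (fun i => blockAvg (P := P) (j := i) (expMeanLogSU (n := Fin N))) j U₀) c : Matrix.specialUnitaryGroup (Fin N) ℂ) : Matrix (Fin N) (Fin N) ℂ)
          + ((corr (expMeanLogSU (n := Fin N)) (Averaging.iter (fun i => blockAvg (P := P) (j := i) (expMeanLogSU (n := Fin N))) j U₀) c : Matrix.specialUnitaryGroup (Fin N) ℂ) : Matrix (Fin N) (Fin N) ℂ)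
            * covWalkSum (Averaging.iter (fun i => blockAvg (P := P) (j := i) (expMeanLogSU (n := Fin N))) j U₀) (pertVar (Averaging.iter (fun i => blockAvg (P := P) (j := i) (expMeanLogSU (n := Fin N))) j U₀) (Averaging.iter (fun i => blockAvg (P := P) (j := i) (expMeanLogSU (n := Fin N))) j W)) (walk (emb c.src) (List.replicate P.L (c.dir, true)))
            * star ((corr (expMeanLogSU (n := Fin N)) (Averaging.iter (fun i => blockAvg (P := P) (j := i) (expMeanLogSU (n := Fin N))) j U₀) c : Matrix.specialUnitaryGroup (Fin N) ℂ) : Matrix (Fin N) (Fin N) ℂ)))) := ⟨_, rfl⟩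
  -- the sourced family `D′_j = Y_j − Q_j X` and its drive (✓A1 `sub_sourced`)
  have hDs : ∀ (j : ℕ) (c : PBond P (j + 1)), (Yf - fun j => Q j X) (j + 1) c
      = (fderiv ℂ (eml : (Idx P → Matrix (Fin N) (Fin N) ℂ) → Matrix (Fin N) (Fin N) ℂ)
            (fun i => ((loopHol (Averaging.iter (fun i => blockAvg (P := P) (j := i) (expMeanLogSU (n := Fin N))) j U₀) c i : Matrix.specialUnitaryGroup (Fin N) ℂ) : Matrix (Fin N) (Fin N) ℂ))
            (fun i => covWalkSum (Averaging.iter (fun i => blockAvg (P := P) (j := i) (expMeanLogSU (n := Fin N))) j U₀) ((Yf - fun j => Q j X) j) (walk (emb c.src) (loopWord P.L c.dir (off i.1) i.2.1 i.2.2))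
              * ((loopHol (Averaging.iter (fun i => blockAvg (P := P) (j := i) (expMeanLogSU (n := Fin N))) j U₀) c i : Matrix.specialUnitaryGroup (Fin N) ℂ) : Matrix (Fin N) (Fin N) ℂ))
            * star ((corr (expMeanLogSU (n := Fin N)) (Averaging.iter (fun i => blockAvg (P := P) (j := i) (expMeanLogSU (n := Fin N))) j U₀) c : Matrix.specialUnitaryGroup (Fin N) ℂ) : Matrix (Fin N) (Fin N) ℂ)
          + ((corr (expMeanLogSU (n := Fin N)) (Averaging.iter (fun i => blockAvg (P := P) (j := i) (expMeanLogSU (n := Fin N))) j U₀) c : Matrix.specialUnitaryGroup (Fin N) ℂ) : Matrix (Fin N) (Fin N) ℂ)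
            * covWalkSum (Averaging.iter (fun i => blockAvg (P := P) (j := i) (expMeanLogSU (n := Fin N))) j U₀) ((Yf - fun j => Q j X) j) (walk (emb c.src) (List.replicate P.L (c.dir, true)))
            * star ((corr (expMeanLogSU (n := Fin N)) (Averaging.iter (fun i => blockAvg (P := P) (j := i) (expMeanLogSU (n := Fin N))) j U₀) c : Matrix.specialUnitaryGroup (Fin N) ℂ) : Matrix (Fin N) (Fin N) ℂ)) + R j c := by
    intro j c
    subst hYf; subst hRf
    exact sub_sourced U₀ (fun j => (pertVar (Averaging.iter (fun i => blockAvg (P := P) (j := i) (expMeanLogSU (n := Fin N))) j U₀) (Averaging.iter (fun i => blockAvg (P := P) (j := i) (expMeanLogSU (n := Fin N))) j W))) (fun j => Q j X) (fun j c => ((pertVar (Averaging.iter (fun i => blockAvg (P := P) (j := i) (expMeanLogSU (n := Fin N))) (j + 1) U₀) (Averaging.iter (fun i => blockAvg (P := P) (j := i) (expMeanLogSU (n := Fin N))) (j + 1) W)) c - (fderiv ℂ (eml : (Idx P → Matrix (Fin N) (Fin N) ℂ) → Matrix (Fin N) (Fin N) ℂ)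
            (fun i => ((loopHol (Averaging.iter (fun i => blockAvg (P := P) (j := i) (expMeanLogSU (n := Fin N))) j U₀) c i : Matrix.specialUnitaryGroup (Fin N) ℂ) : Matrix (Fin N) (Fin N) ℂ))
            (fun i => covWalkSum (Averaging.iter (fun i => blockAvg (P := P) (j := i) (expMeanLogSU (n := Fin N))) j U₀) (pertVar (Averaging.iter (fun i => blockAvg (P := P) (j := i) (expMeanLogSU (n := Fin N))) j U₀) (Averaging.iter (fun i => blockAvg (P := P) (j := i) (expMeanLogSU (n := Fin N))) j W)) (walk (emb c.src) (loopWord P.L c.dir (off i.1) i.2.1 i.2.2))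
              * ((loopHol (Averaging.iter (fun i => blockAvg (P := P) (j := i) (expMeanLogSU (n := Fin N))) j U₀) c i : Matrix.specialUnitaryGroup (Fin N) ℂ) : Matrix (Fin N) (Fin N) ℂ))
            * star ((corr (expMeanLogSU (n := Fin N)) (Averaging.iter (fun i => blockAvg (P := P) (j := i) (expMeanLogSU (n := Fin N))) j U₀) c : Matrix.specialUnitaryGroup (Fin N) ℂ) : Matrix (Fin N) (Fin N) ℂ)
          + ((corr (expMeanLogSU (n := Fin N)) (Averaging.iter (fun i => blockAvg (P := P) (j := i) (expMeanLogSU (n := Fin N))) j U₀) c : Matrix.specialUnitaryGroup (Fin N) ℂ) : Matrix (Fin N) (Fin N) ℂ)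
            * covWalkSum (Averaging.iter (fun i => blockAvg (P := P) (j := i) (expMeanLogSU (n := Fin N))) j U₀) (pertVar (Averaging.iter (fun i => blockAvg (P := P) (j := i) (expMeanLogSU (n := Fin N))) j U₀) (Averaging.iter (fun i => blockAvg (P := P) (j := i) (expMeanLogSU (n := Fin N))) j W)) (walk (emb c.src) (List.replicate P.L (c.dir, true)))
            * star ((corr (expMeanLogSU (n := Fin N)) (Averaging.iter (fun i => blockAvg (P := P) (j := i) (expMeanLogSU (n := Fin N))) j U₀) c : Matrix.specialUnitaryGroup (Fin N) ℂ) : Matrix (Fin N) (Fin N) ℂ)))) (fun j c => by rw [add_sub_cancel]) (fun j c => hQs j _ c) j c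
  -- the recursion families
  obtain ⟨G, hG0, hGs⟩ := exists_sourced_reduced_family (n := Fin N) U₀ (fun b => pertVar U₀ W b - X b) R
  obtain ⟨Λ, hΛ0, hΛs⟩ := exists_coarseGauge_family U₀ G
  have hG0' : ∀ b, G 0 b = (Yf - fun j => Q j X) 0 b := by
    intro b
    rw [hG0, hYf]
    simp only [Pi.sub_apply, hQ0]
    rfl
  -- ★★★ THE SPARSE ENGINE (✓p708624)
  have hmain := sum_norm_sourced_le_sparse U₀ R (Yf - fun j => Q j X) hDs G hG0' hGs Λ hΛ0 hΛs a ha0 hk hα ha24 haN S hS hSk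
  have hDk : ∀ c : PBond P k, (Yf - fun j => Q j X) k c = (pertVar (Averaging.iter (fun i => blockAvg (P := P) (j := i) (expMeanLogSU (n := Fin N))) k U₀) (Averaging.iter (fun i => blockAvg (P := P) (j := i) (expMeanLogSU (n := Fin N))) k W)) c - Q k X c := by
    intro c; rw [hYf]; rfl
  have hD0 : ∑ b : PBond P 0, ‖(Yf - fun j => Q j X) 0 b‖ = (∑ b : PBond P 0, ‖pertVar U₀ W b - X b‖) := by
    refine Finset.sum_congr rfl fun b _ => ?_
    rw [hYf]
    simp only [Pi.sub_apply, hQ0]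
    rfl
  simp only [hDk, hD0] at hmain
  -- positivity letters
  have hLpos : (0 : ℝ) < (P.L : ℝ) := by exact_mod_cast P.L_pos
  have hρ0 : (0 : ℝ) ≤ (((P.L : ℝ) ^ P.d)⁻¹ * (P.L : ℝ)) := by positivity
  have hcE0 : (0 : ℝ) ≤ (260 * ((((P.d + 2) * P.L : ℕ) : ℝ)) ^ 2 * (2 * P.d * (P.L : ℝ) ^ P.d) * (2 * P.d)) := by positivity
  have hE0 : ∀ j, 0 ≤ Real.exp ((159 * (((P.d + 2) * P.L : ℕ) : ℝ) * (2 * P.d)) / (((P.L : ℝ) ^ P.d)⁻¹ * (P.L : ℝ)) * ∑ i ∈ Finset.range j, a i) := fun j => (Real.exp_pos _).le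
  have hC0 : (0 : ℝ) ≤ (((P.d + 2) * P.L : ℕ) : ℝ) := Nat.cast_nonneg _
  -- the remainders in E10's product form
  have hRform : ∀ (l : ℕ) (c : PBond P (l + 1)), R l c
      = ((avgFun (expMeanLogSU (n := Fin N)) (Averaging.iter (fun i => blockAvg (P := P) (j := i) (expMeanLogSU (n := Fin N))) l W) c : Matrix.specialUnitaryGroup (Fin N) ℂ) : Matrix (Fin N) (Fin N) ℂ) *
          star ((avgFun (expMeanLogSU (n := Fin N)) (Averaging.iter (fun i => blockAvg (P := P) (j := i) (expMeanLogSU (n := Fin N))) l U₀) c : Matrix.specialUnitaryGroup (Fin N) ℂ) : Matrix (Fin N) (Fin N) ℂ) - 1 -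
        (fderiv ℂ (eml : (Idx P → Matrix (Fin N) (Fin N) ℂ) → Matrix (Fin N) (Fin N) ℂ)
            (fun i => ((loopHol (Averaging.iter (fun i => blockAvg (P := P) (j := i) (expMeanLogSU (n := Fin N))) l U₀) c i : Matrix.specialUnitaryGroup (Fin N) ℂ) : Matrix (Fin N) (Fin N) ℂ))
            (fun i => covWalkSum (Averaging.iter (fun i => blockAvg (P := P) (j := i) (expMeanLogSU (n := Fin N))) l U₀) (pertVar (Averaging.iter (fun i => blockAvg (P := P) (j := i) (expMeanLogSU (n := Fin N))) l U₀) (Averaging.iter (fun i => blockAvg (P := P) (j := i) (expMeanLogSU (n := Fin N))) l W)) (walk (emb c.src) (loopWord P.L c.dir (off i.1) i.2.1 i.2.2))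
              * ((loopHol (Averaging.iter (fun i => blockAvg (P := P) (j := i) (expMeanLogSU (n := Fin N))) l U₀) c i : Matrix.specialUnitaryGroup (Fin N) ℂ) : Matrix (Fin N) (Fin N) ℂ))
            * star ((corr (expMeanLogSU (n := Fin N)) (Averaging.iter (fun i => blockAvg (P := P) (j := i) (expMeanLogSU (n := Fin N))) l U₀) c : Matrix.specialUnitaryGroup (Fin N) ℂ) : Matrix (Fin N) (Fin N) ℂ)
          + ((corr (expMeanLogSU (n := Fin N)) (Averaging.iter (fun i => blockAvg (P := P) (j := i) (expMeanLogSU (n := Fin N))) l U₀) c : Matrix.specialUnitaryGroup (Fin N) ℂ) : Matrix (Fin N) (Fin N) ℂ)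
            * covWalkSum (Averaging.iter (fun i => blockAvg (P := P) (j := i) (expMeanLogSU (n := Fin N))) l U₀) (pertVar (Averaging.iter (fun i => blockAvg (P := P) (j := i) (expMeanLogSU (n := Fin N))) l U₀) (Averaging.iter (fun i => blockAvg (P := P) (j := i) (expMeanLogSU (n := Fin N))) l W)) (walk (emb c.src) (List.replicate P.L (c.dir, true)))
            * star ((corr (expMeanLogSU (n := Fin N)) (Averaging.iter (fun i => blockAvg (P := P) (j := i) (expMeanLogSU (n := Fin N))) l U₀) c : Matrix.specialUnitaryGroup (Fin N) ℂ) : Matrix (Fin N) (Fin N) ℂ)) := by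
    intro l c
    rw [hRf]
    simp only
    rw [pertVar_eq]
    rfl
  -- GLOBAL source row (px7 g4 E10-loc at `C = univ`, `S = univ`)
  have hRglob : ∀ l < k, ∑ c : PBond P (l + 1), ‖R l c‖ ≤ (260 * ((((P.d + 2) * P.L : ℕ) : ℝ)) ^ 2 * (2 * P.d * (P.L : ℝ) ^ P.d) * (2 * P.d)) * ∑ b : PBond P l, ‖(pertVar (Averaging.iter (fun i => blockAvg (P := P) (j := i) (expMeanLogSU (n := Fin N))) l U₀) (Averaging.iter (fun i => blockAvg (P := P) (j := i) (expMeanLogSU (n := Fin N))) l W)) b‖ ^ 2 := by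
    intro l hl
    have h := sum_norm_ratio_sub_trueLin_le_mass_local (by omega) (Averaging.iter (fun i => blockAvg (P := P) (j := i) (expMeanLogSU (n := Fin N))) l U₀) (Averaging.iter (fun i => blockAvg (P := P) (j := i) (expMeanLogSU (n := Fin N))) l W)
      (univ : Finset (PBond P (l + 1))) (univ : Finset (PBond P l)) (fun c _ b _ => Finset.mem_univ b)
      (fun c _ i => hα l hl c i) (ha24 l hl) (hs0 l hl) (fun b _ => hs l hl b) (h72 l hl) (hsN l hl)
    simp only [← hRform] at h
    exact h
  -- LOCAL source row on the support families (px7 g4 E10-loc at `C = C j z (i+1)`, `S = C j z i`)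
  have hRloc : ∀ j < k, ∀ z ∈ S (j + 1), ∀ i < j, ∑ c ∈ C j z (i + 1), ‖R i c‖ ≤ (260 * ((((P.d + 2) * P.L : ℕ) : ℝ)) ^ 2 * (2 * P.d * (P.L : ℝ) ^ P.d) * (2 * P.d)) * ∑ b ∈ C j z i, ‖(pertVar (Averaging.iter (fun i => blockAvg (P := P) (j := i) (expMeanLogSU (n := Fin N))) i U₀) (Averaging.iter (fun i => blockAvg (P := P) (j := i) (expMeanLogSU (n := Fin N))) i W)) b‖ ^ 2 := by
    intro j hj z hz i hi
    have hik : i < k := hi.trans hj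
    have h := sum_norm_ratio_sub_trueLin_le_mass_local (by omega) (Averaging.iter (fun i => blockAvg (P := P) (j := i) (expMeanLogSU (n := Fin N))) i U₀) (Averaging.iter (fun i => blockAvg (P := P) (j := i) (expMeanLogSU (n := Fin N))) i W)
      (C j z (i + 1)) (C j z i) (hCnest j hj z hz i hi)
      (fun c _ idx => hα i hik c idx) (ha24 i hik) (hs0 i hik) (fun b _ => hs i hik b) (h72 i hik) (hsN i hik)
    simp only [← hRform] at h
    exact h
  -- the mass channel: monotonicity of the right-hand side in the sources
  have hS1 : (∑ i ∈ Finset.range k, (((P.L : ℝ) ^ P.d)⁻¹ * (P.L : ℝ)) ^ (k - 1 - i) * ∑ c : PBond P (i + 1), ‖R i c‖)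
      ≤ ∑ i ∈ Finset.range k, (((P.L : ℝ) ^ P.d)⁻¹ * (P.L : ℝ)) ^ (k - 1 - i) * ((260 * ((((P.d + 2) * P.L : ℕ) : ℝ)) ^ 2 * (2 * P.d * (P.L : ℝ) ^ P.d) * (2 * P.d)) * ∑ b : PBond P i, ‖(pertVar (Averaging.iter (fun i => blockAvg (P := P) (j := i) (expMeanLogSU (n := Fin N))) i U₀) (Averaging.iter (fun i => blockAvg (P := P) (j := i) (expMeanLogSU (n := Fin N))) i W)) b‖ ^ 2) :=
    Finset.sum_le_sum fun i hi => mul_le_mul_of_nonneg_left (hRglob i (Finset.mem_range.mp hi)) (pow_nonneg hρ0 _)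
  -- the block terms: `Σ_{blockOf b₋ = z} ≤ Σ_{C j z j}` then ✓p708624 §2 on the nested family, then the local source row
  have hblock : ∀ j ∈ Finset.range k, ∀ z ∈ S (j + 1),
      ∑ b ∈ univ.filter (fun b : PBond P j => blockOf b.src = z), ‖G j b‖
        ≤ Real.exp ((159 * (((P.d + 2) * P.L : ℕ) : ℝ) * (2 * P.d)) / (((P.L : ℝ) ^ P.d)⁻¹ * (P.L : ℝ)) * ∑ i ∈ Finset.range j, a i)
            * ((((P.L : ℝ) ^ P.d)⁻¹ * (P.L : ℝ)) ^ j * (∑ b ∈ C j z 0, ‖pertVar U₀ W b - X b‖)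
              + ∑ i ∈ Finset.range j, (((P.L : ℝ) ^ P.d)⁻¹ * (P.L : ℝ)) ^ (j - 1 - i) * ((260 * ((((P.d + 2) * P.L : ℕ) : ℝ)) ^ 2 * (2 * P.d * (P.L : ℝ) ^ P.d) * (2 * P.d)) * ∑ b ∈ C j z i, ‖(pertVar (Averaging.iter (fun i => blockAvg (P := P) (j := i) (expMeanLogSU (n := Fin N))) i U₀) (Averaging.iter (fun i => blockAvg (P := P) (j := i) (expMeanLogSU (n := Fin N))) i W)) b‖ ^ 2)) := by
    intro j hj z hz
    have hjk : j < k := Finset.mem_range.mp hj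
    have h1 : ∑ b ∈ univ.filter (fun b : PBond P j => blockOf b.src = z), ‖G j b‖ ≤ ∑ b ∈ C j z j, ‖G j b‖ :=
      Finset.sum_le_sum_of_subset_of_nonneg (fun b hb => hCtop j hjk z hz b (Finset.mem_filter.mp hb).2) fun b _ _ => norm_nonneg _
    have h2 := sum_norm_sourcedReduced_le_local U₀ R G hGs a ha0 (hjk.le.trans hk) (C j z) (hCnest j hjk z hz)
      (fun i hi c _ idx => hα i (hi.trans hjk) c idx) (fun i hi => ha24 i (hi.trans hjk)) (fun i hi => haN i (hi.trans hjk))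
    have h3 : ∑ b ∈ C j z 0, ‖G 0 b‖ = ∑ b ∈ C j z 0, ‖pertVar U₀ W b - X b‖ :=
      Finset.sum_congr rfl fun b _ => by rw [hG0]
    rw [h3] at h2
    have h4 : (∑ i ∈ Finset.range j, (((P.L : ℝ) ^ P.d)⁻¹ * (P.L : ℝ)) ^ (j - 1 - i) * ∑ c ∈ C j z (i + 1), ‖R i c‖)
        ≤ ∑ i ∈ Finset.range j, (((P.L : ℝ) ^ P.d)⁻¹ * (P.L : ℝ)) ^ (j - 1 - i) * ((260 * ((((P.d + 2) * P.L : ℕ) : ℝ)) ^ 2 * (2 * P.d * (P.L : ℝ) ^ P.d) * (2 * P.d)) * ∑ b ∈ C j z i, ‖(pertVar (Averaging.iter (fun i => blockAvg (P := P) (j := i) (expMeanLogSU (n := Fin N))) i U₀) (Averaging.iter (fun i => blockAvg (P := P) (j := i) (expMeanLogSU (n := Fin N))) i W)) b‖ ^ 2) :=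
      Finset.sum_le_sum fun i hi => mul_le_mul_of_nonneg_left (hRloc j hjk z hz i (Finset.mem_range.mp hi)) (pow_nonneg hρ0 _)
    exact h1.trans (h2.trans (mul_le_mul_of_nonneg_left (add_le_add le_rfl h4) (hE0 j)))
  have hΛsum : (∑ j ∈ Finset.range k, (((P.d + 2) * P.L : ℕ) : ℝ) * ∑ z ∈ S (j + 1),
        ∑ b ∈ univ.filter (fun b : PBond P j => blockOf b.src = z), ‖G j b‖)
      ≤ ∑ j ∈ Finset.range k, (((P.d + 2) * P.L : ℕ) : ℝ) * ∑ z ∈ S (j + 1),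
            Real.exp ((159 * (((P.d + 2) * P.L : ℕ) : ℝ) * (2 * P.d)) / (((P.L : ℝ) ^ P.d)⁻¹ * (P.L : ℝ)) * ∑ i ∈ Finset.range j, a i)
              * ((((P.L : ℝ) ^ P.d)⁻¹ * (P.L : ℝ)) ^ j * (∑ b ∈ C j z 0, ‖pertVar U₀ W b - X b‖)
                + ∑ i ∈ Finset.range j, (((P.L : ℝ) ^ P.d)⁻¹ * (P.L : ℝ)) ^ (j - 1 - i) * ((260 * ((((P.d + 2) * P.L : ℕ) : ℝ)) ^ 2 * (2 * P.d * (P.L : ℝ) ^ P.d) * (2 * P.d)) * ∑ b ∈ C j z i, ‖(pertVar (Averaging.iter (fun i => blockAvg (P := P) (j := i) (expMeanLogSU (n := Fin N))) i U₀) (Averaging.iter (fun i => blockAvg (P := P) (j := i) (expMeanLogSU (n := Fin N))) i W)) b‖ ^ 2)) :=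
    Finset.sum_le_sum fun j hj => mul_le_mul_of_nonneg_left (Finset.sum_le_sum fun z hz => hblock j hj z hz) hC0
  have hd0 : (0 : ℝ) ≤ 2 * P.d := by positivity
  have hA := mul_le_mul_of_nonneg_left (add_le_add (le_refl ((((P.L : ℝ) ^ P.d)⁻¹ * (P.L : ℝ)) ^ k * (∑ b : PBond P 0, ‖pertVar U₀ W b - X b‖))) hS1) (hE0 k)
  have hB := mul_le_mul_of_nonneg_left hΛsum hd0
  linarith [hmain, hA, hB]

end Summit.QuantumFields.YangMills.Theorems.Prop7N32SymSparseRow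

end
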